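import Literature.MathematicalPhysics.QuantumLattice.HubbardTTPrimeGrandCanonicalThermalStatesEnsembles
import Literature.MathematicalPhysics.QuantumLattice.HubbardTTPrimeThermalPressureSpinSectorsDuality
import Literature.MathematicalPhysics.QuantumLattice.HubbardTTPrimeThermalPressureSpinSectorsConcave
import HarnessLib

/-!
# Thermal grand-canonical states of the 2D `t–t'` Hubbard model, III: spin densities in a Zeeman field are
# interior, attain the two-variable Legendre transform, and lie in explicit windows

Family `hubbard` (topic `MathematicalPhysics/QuantumLattice`). The field-axis completion of
`HubbardTTPrimeGrandCanonicalThermalStatesEnsembles` (`0 < ρ(ω) < 2` and `p(ρ(ω)) + βμρ(ω) = P(μ)` at `h = 0`), on top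
of the number files `HubbardTTPrimeGrandCanonicalPressureZeeman` (`P(μ,h)`), `HubbardTTPrimeThermalPressureSpinSectors{,Concave,Duality}`
(`p₂(x,y)`, its spin-resolved density legs, spin swap, `p₂(x,y) = inf_{(μ,h)} [P(μ,h) − βμ(x+y) − βh(x−y)]`). In the
variables `a = μ + h`, `b = μ − h` conjugate to `(n↑, n↓)` (`βμ(x+y) + βh(x−y) = βax + βby`):

* §1 NUMBERS (`β ≥ 0`, `U ≥ 0`): the spin-down Legendre set `{p₂(0,y) + βby}` is bounded by `P` (`…_le_gcPressureTT'Zeeman`,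
  `bddAbove_spinDownLegendreSet`); **decay in `a`**: `P ≤ sup_y[p₂(0,y) + βby] + e^{−λ}` once `β(a + 4|t| + 4|t'|) ≤ −λ`
  (`gcPressureTT'Zeeman_le_spinDownSup_add_exp`); **strict gap**: `sup_y[p₂(0,y) + βby] + e^{−(β(4|t|+4|t'|+U+|a|)+1)} ≤ P`
  (`spinDownSup_add_exp_le_gcPressureTT'Zeeman`); hence **every subgradient of `a ↦ P` lies in `(0, 1)`** for `β > 0`
  (`pos_/lt_one_of_forall_mul_sub_le_gcPressureTT'Zeeman_spinUp_sub`; the upper bound through particle–hole symmetry in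
  the spin variables, `gcPressureTT'Zeeman_particleHole_spin`: `(a, b) ↦ (U − a, U − b)`); spin swap `a ↔ b`
  (`gcPressureTT'Zeeman_spin_swap`). THE SPIN-RESOLVED BANDS of an attained pair `(x,y) ↔ (μ,h)`
  (`p₂(x,y) + βμ(x+y) + βh(x−y) = P(μ,h)`, `(x,y) ∈ (0,1)²`):
  `log(x/(1−x)) − β(4|t|+4|t'|) ≤ β(μ+h) ≤ log(x/(1−x)) + β(4|t|+4|t'|+U)` (`spinUp_chemicalPotential_mem_band`: chords of the
  spin-up leg against the binary-entropy tangents `mul_log_le_two_mul_binEntropy_sub` / `two_mul_binEntropy_sub_le_mul_log`,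
  then `x' → x`) and the spin-down twin (`spinDown_…`, by swap).
* §2 STATES (`ω` thermal grand-canonical at `(β; t,t',U; μ,h)`, `β > 0`, `U ≥ 0`): `(ρ, m)` is a JOINT subgradient of `P` in
  `(μ,h)` (`IsTorusLimitOfMixture.mul_density_add_mul_magnetisation_le_gcPressureTT'Zeeman_sub_of_gcGibbs`), i.e. `ρ↑(ω)` /
  `ρ↓(ω)` are subgradients in `a` / `b` (`…mul_spinUp_/mul_spinDown_mul_sub_le_…`); hence **`0 < ρ↑(ω) < 1` and
  `0 < ρ↓(ω) < 1`** (`spinUp_/spinDown_mem_Ioo_of_gcGibbs`), **THE `(n↑,n↓) ↔ (μ,h)` DUALITY AT THE STATE LEVEL**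
  `p₂(ρ↑(ω), ρ↓(ω)) + βμρ(ω) + βh m(ω) = P(μ,h)` (`pressureTT'₂_add_eq_gcPressureTT'Zeeman_of_gcGibbs`), and
  **THE HYPOTHESIS-FREE SPIN-DENSITY WINDOWS** `σ(β(μ±h) − β(4|t|+4|t'|+U)) ≤ ρ_{↑/↓}(ω) ≤ σ(β(μ±h) + β(4|t|+4|t'|))`,
  `σ(z) = e^z/(1+e^z)` (`spinDensities_mem_Icc_logistic_of_gcGibbs`) — the ideal spin-½ lattice gas in the field displaced
  by one bandwidth; their difference is a magnetisation window on the field axis of a phase map.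

Everything is PROVED; no definition, no named fact, no sorry (four private real-analysis helpers are re-proved from the
companion file). WHAT THIS IS NOT: uniqueness of `(ρ↑, ρ↓)` at given `(μ, h)`; a number of record; a phase word.

## Mathlib / tree search

`lean search 'spinUp.*band|spinDensit.*gcGibbs|particleHole_spin'`: nothing (2026-08-27). REUSED:
`pressureTT'₂_sub_binEntropy_sub_mem_fst` (`HubbardTTPrimeThermalPressureSpinSectors`), `pressureTT'₂_swap`
(`…SpinSectorsConcave`), `pressureTT'₂_add_le_gcPressureTT'Zeeman`, `gcPressureTT'Zeeman_le_iff`, `gcPressureTT'Zeeman_neg`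
(`…PressureZeeman`), `pressureTT'₂_eq_iInf_gcPressureTT'Zeeman` (`…SpinSectorsDuality`), `mul_log_le_two_mul_binEntropy_sub`,
`two_mul_binEntropy_sub_le_mul_log` (`HubbardTTPrimeThermalPressureDensityBand`), `gcPressureTT'Zeeman_particleHole`
(`HubbardTTPrimeGrandCanonicalThermalStatesEnsembles`), `IsTorusLimitOfMixture.gcPressureTT'Zeeman_sub_le_of_gcGibbs`
(`HubbardTTPrimeGrandCanonicalThermalStates`).

## References

* D. Ruelle, *Statistical Mechanics: Rigorous Results* (1969), §3.4. [cite: Ruelle1969, §3.4]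
* R. B. Israel, *Convexity in the Theory of Lattice Gases* (1979), Thm. I.2.4. [cite: Israel1979, Thm. I.2.4]
* R. B. Griffiths, J. Math. Phys. 5 (1964) 1215. [cite: Griffiths1964]
* E. H. Lieb, F. Y. Wu, Physica A 321 (2003) 1, §1 eq. (3) (particle–hole transformation). [cite: LiebWuPhysicaA2003, §1 eq. (3)]
* E. H. Lieb, Phys. Rev. Lett. 62 (1989) 1201 (the `(N↑, N↓)` sectors; spin flip). [cite: LiebPRL1989, proof of Theorem 1]
* H. Araki, H. Moriya, Rev. Math. Phys. 15 (2003) 93, §4.1 (number operators of the fermion lattice algebra). [cite: ArakiMoriya2003, §4.1]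
-/

noncomputable section

namespace Literature.MathematicalPhysics.QuantumLattice

open Matrix Finset HubbardWave0 Literature.Probability.LatticeModels ThermodynamicLimit LiebThm1
open _root_.Filter
open scoped _root_.Topology ComplexOrder BigOperators

section RealAnalysis

/-- `H_b(x) ≥ x log(1/x)` on `[0,1]`. [folklore] -/
private theorem mul_log_inv_le_binEntropy' {x : ℝ} (hx0 : 0 ≤ x) (hx1 : x ≤ 1) :
    x * Real.log x⁻¹ ≤ Real.binEntropy x := by
  rw [Real.binEntropy]
  have h : 0 ≤ (1 - x) * Real.log (1 - x)⁻¹ := by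
    rcases hx1.lt_or_eq with hlt | heq
    · exact mul_nonneg (by linarith) (Real.log_nonneg (one_le_inv_iff₀.2 ⟨by linarith, by linarith⟩))
    · rw [heq, sub_self, zero_mul]
  linarith

/-- `H_b(x) ≤ x log(1/x) + x` on `[0,1]`. [folklore] -/
private theorem binEntropy_le_mul_log_inv_add' {x : ℝ} (hx1 : x ≤ 1) :
    Real.binEntropy x ≤ x * Real.log x⁻¹ + x := by
  rw [Real.binEntropy]
  have h : (1 - x) * Real.log (1 - x)⁻¹ ≤ x := by
    rcases hx1.lt_or_eq with hlt | heq
    · have hpos : 0 < 1 - x := by linarith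
      rw [Real.log_inv]
      have hlog := Real.one_sub_inv_le_log_of_pos hpos
      have : (1 - x) * (1 - (1 - x)⁻¹) = (1 - x) - 1 := by field_simp
      nlinarith [mul_le_mul_of_nonneg_left hlog hpos.le]
    · rw [heq, sub_self, zero_mul]; linarith
  linarith

/-- `x (a − log x) ≤ e^{a−1}` for `x ≥ 0`. [folklore] -/
private theorem mul_sub_log_le_exp' (a : ℝ) {x : ℝ} (hx : 0 ≤ x) : x * (a - Real.log x) ≤ Real.exp (a - 1) := by
  rcases hx.lt_or_eq with hpos | h0
  · have hq : 0 < x / Real.exp (a - 1) := div_pos hpos (Real.exp_pos _)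
    have h := Real.one_sub_inv_le_log_of_pos hq
    rw [Real.log_div hpos.ne' (Real.exp_pos _).ne', Real.log_exp, inv_div] at h
    have h2 := mul_le_mul_of_nonneg_left h hpos.le
    have e : x * (1 - Real.exp (a - 1) / x) = x - Real.exp (a - 1) := by field_simp
    rw [e] at h2
    nlinarith
  · rw [← h0, zero_mul]; exact (Real.exp_pos _).le

/-- `H_b(x) − λx ≤ e^{−λ}` on `[0,1]`. [folklore] -/
private theorem binEntropy_sub_mul_le_exp_neg' (lam : ℝ) {x : ℝ} (hx0 : 0 ≤ x) (hx1 : x ≤ 1) :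
    Real.binEntropy x - lam * x ≤ Real.exp (-lam) := by
  have h1 := binEntropy_le_mul_log_inv_add' hx1
  have h2 := mul_sub_log_le_exp' (1 - lam) hx0
  rw [show (1 - lam - 1 : ℝ) = -lam by ring] at h2
  have e : x * (1 - lam - Real.log x) = x * Real.log x⁻¹ + x - lam * x := by rw [Real.log_inv]; ring
  linarith

/-- `x ↦ log(x/(1 − x))` is continuous at every `x ∈ (0, 1)`. [folklore] -/
private theorem continuousAt_log_div_one_sub {x : ℝ} (hx0 : 0 < x) (hx1 : x < 1) :
    ContinuousAt (fun u : ℝ => Real.log (u / (1 - u))) x := by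
  have h1 : ContinuousAt (fun u : ℝ => u / (1 - u)) x :=
    (continuousAt_id.div (continuousAt_const.sub continuousAt_id) (by exact sub_ne_zero.2 (ne_of_lt hx1).symm))
  exact h1.log (div_pos hx0 (by linarith)).ne'

end RealAnalysis

namespace ThermodynamicLimit

/-! ### §1 Numbers: the Zeeman pressure in the variables `a = μ + h`, `b = μ − h` conjugate to `(n↑, n↓)`;
decay and strict gap in each variable; particle–hole in `(a, b)`; subgradients lie in `(0, 1)` -/

section SpinVariables

variable {β : ℝ} (hβ : 0 ≤ β) (t t' : ℝ) {U : ℝ} (hU : 0 ≤ U)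
include hβ hU

/-- The Legendre set of the spin-down variable alone is bounded above by the pressure:
`p₂(0,y) + βby ≤ P((a+b)/2, (a−b)/2)` for all `y ∈ [0,1)` and every `a`. [cite: Ruelle1969, §3.4] -/
theorem pressureTT'₂_zero_add_le_gcPressureTT'Zeeman (a b : ℝ) {y : ℝ} (hy0 : 0 ≤ y) (hy1 : y < 1) :
    pressureTT'₂ β t t' U 0 y + β * b * y ≤ gcPressureTT'Zeeman β t t' U ((a + b) / 2) ((a - b) / 2) := by
  have h := pressureTT'₂_add_le_gcPressureTT'Zeeman hβ t t' hU ((a + b) / 2) ((a - b) / 2) le_rfl one_pos hy0 hy1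
  have e : β * ((a + b) / 2) * (0 + y) + β * ((a - b) / 2) * (0 - y) = β * b * y := by ring
  linarith

/-- The spin-down Legendre set `{p₂(0,y) + βby : y ∈ [0,1)}` is bounded above. [cite: Ruelle1969, §3.4] -/
theorem bddAbove_spinDownLegendreSet (b : ℝ) :
    BddAbove ((fun y : ℝ => pressureTT'₂ β t t' U 0 y + β * b * y) '' Set.Ico (0 : ℝ) 1) :=
  ⟨gcPressureTT'Zeeman β t t' U ((0 + b) / 2) ((0 - b) / 2), by
    rintro _ ⟨y, hy, rfl⟩
    exact pressureTT'₂_zero_add_le_gcPressureTT'Zeeman hβ t t' hU 0 b hy.1 hy.2⟩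

/-- **Decay in the spin-up variable**: if `β(a₁ + 4|t| + 4|t'|) ≤ −λ` then
`P((a₁+b)/2, (a₁−b)/2) ≤ sup_y [p₂(0,y) + βby] + e^{−λ}` (the spin-up density leg
`p₂(x,y) ≤ p₂(0,y) + H_b(x) + β(4|t|+4|t'|)x` and `H_b(x) − λx ≤ e^{−λ}`). [cite: Ruelle1969, §3.4] -/
theorem gcPressureTT'Zeeman_le_spinDownSup_add_exp (a₁ b lam : ℝ) (ha : β * (a₁ + (4 * |t| + 4 * |t'|)) ≤ -lam) :
    gcPressureTT'Zeeman β t t' U ((a₁ + b) / 2) ((a₁ - b) / 2) ≤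
      sSup ((fun y : ℝ => pressureTT'₂ β t t' U 0 y + β * b * y) '' Set.Ico (0 : ℝ) 1) + Real.exp (-lam) := by
  rw [gcPressureTT'Zeeman_le_iff hβ t t' hU]
  intro x y hx0 hx1 hy0 hy1
  have hleg := (pressureTT'₂_sub_binEntropy_sub_mem_fst hβ t t' hU (x := 0) le_rfl hx0 hx1 hy0 hy1).2
  rw [Real.binEntropy_zero, sub_zero, sub_zero] at hleg
  have hH := binEntropy_sub_mul_le_exp_neg' lam hx0 hx1.le
  have hsup : pressureTT'₂ β t t' U 0 y + β * b * y ≤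
      sSup ((fun y : ℝ => pressureTT'₂ β t t' U 0 y + β * b * y) '' Set.Ico (0 : ℝ) 1) :=
    le_csSup (bddAbove_spinDownLegendreSet hβ t t' hU b) ⟨y, ⟨hy0, hy1⟩, rfl⟩
  have hax : β * (a₁ + (4 * |t| + 4 * |t'|)) * x ≤ -lam * x := mul_le_mul_of_nonneg_right ha hx0
  have e : β * ((a₁ + b) / 2) * (x + y) + β * ((a₁ - b) / 2) * (x - y) = β * a₁ * x + β * b * y := by ring
  rw [e]
  nlinarith

/-- **Strict gap in the spin-up variable**: `sup_y [p₂(0,y) + βby] + e^{−(β(4|t|+4|t'|+U+|a|)+1)} ≤ P((a+b)/2, (a−b)/2)`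
(put spin-up density `x = e^{−(β(4|t|+4|t'|+U+|a|)+1)}` next to any spin-down density `y`: the entropy `H_b(x) ≥ x log(1/x)`
beats the linear costs). [cite: Ruelle1969, §3.4] [cite: Israel1979, Thm. I.2.4] -/
theorem spinDownSup_add_exp_le_gcPressureTT'Zeeman (a b : ℝ) :
    sSup ((fun y : ℝ => pressureTT'₂ β t t' U 0 y + β * b * y) '' Set.Ico (0 : ℝ) 1) +
        Real.exp (-(β * (4 * |t| + 4 * |t'| + U + |a|) + 1)) ≤
      gcPressureTT'Zeeman β t t' U ((a + b) / 2) ((a - b) / 2) := by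
  set K : ℝ := β * (4 * |t| + 4 * |t'| + U + |a|) + 1 with hK
  set x : ℝ := Real.exp (-K) with hx
  have hK0 : 0 < K := by
    have : 0 ≤ β * (4 * |t| + 4 * |t'| + U + |a|) := by positivity
    linarith
  have hx0 : 0 < x := Real.exp_pos _
  have hx1 : x < 1 := by rw [hx]; exact Real.exp_lt_one_iff.2 (by linarith)
  have hne : ((fun y : ℝ => pressureTT'₂ β t t' U 0 y + β * b * y) '' Set.Ico (0 : ℝ) 1).Nonempty :=
    ⟨_, ⟨0, ⟨le_rfl, one_pos⟩, rfl⟩⟩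
  rw [← le_sub_iff_add_le]
  refine csSup_le hne ?_
  rintro _ ⟨y, ⟨hy0, hy1⟩, rfl⟩
  have hleg := (pressureTT'₂_sub_binEntropy_sub_mem_fst hβ t t' hU (x := 0) le_rfl hx0.le hx1 hy0 hy1).1
  rw [Real.binEntropy_zero, sub_zero, sub_zero] at hleg
  have hP := pressureTT'₂_add_le_gcPressureTT'Zeeman hβ t t' hU ((a + b) / 2) ((a - b) / 2) hx0.le hx1 hy0 hy1
  have hent : x * K ≤ Real.binEntropy x := by
    have h1 := mul_log_inv_le_binEntropy' hx0.le hx1.le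
    have hlogx : Real.log x⁻¹ = K := by rw [hx, Real.log_inv, Real.log_exp, neg_neg]
    rw [hlogx] at h1
    exact h1
  have hax : -(β * |a| * x) ≤ β * a * x := by
    have h := mul_le_mul_of_nonneg_left (neg_abs_le a) (mul_nonneg hβ hx0.le)
    have e1 : β * x * -|a| = -(β * |a| * x) := by ring
    have e2 : β * x * a = β * a * x := by ring
    rw [e1, e2] at h
    exact h
  have e : β * ((a + b) / 2) * (x + y) + β * ((a - b) / 2) * (x - y) = β * a * x + β * b * y := by ring
  have eK : x * K = β * (4 * |t| + 4 * |t'| + U) * x + β * |a| * x + x := by rw [hK]; ring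
  linarith

/-- **Subgradients of the pressure in the spin-up variable `a = μ + h` are POSITIVE** (`β > 0`): if
`βc(a₁ − a) ≤ P((a₁+b)/2,(a₁−b)/2) − P((a+b)/2,(a−b)/2)` for every `a₁`, then `0 < c`.
[cite: Ruelle1969, §3.4] [cite: Griffiths1964] -/
theorem pos_of_forall_mul_sub_le_gcPressureTT'Zeeman_spinUp_sub (hβ' : 0 < β) (a b : ℝ) {c : ℝ}
    (hc : ∀ a₁ : ℝ, β * c * (a₁ - a) ≤ gcPressureTT'Zeeman β t t' U ((a₁ + b) / 2) ((a₁ - b) / 2) -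
      gcPressureTT'Zeeman β t t' U ((a + b) / 2) ((a - b) / 2)) :
    0 < c := by
  by_contra hc0
  push Not at hc0
  set S := sSup ((fun y : ℝ => pressureTT'₂ β t t' U 0 y + β * b * y) '' Set.Ico (0 : ℝ) 1) with hS
  set η : ℝ := Real.exp (-(β * (4 * |t| + 4 * |t'| + U + |a|) + 1)) with hη
  have hη0 : 0 < η := Real.exp_pos _
  have hgap := spinDownSup_add_exp_le_gcPressureTT'Zeeman hβ t t' hU a b
  set lam : ℝ := -Real.log (η / 2) with hlam
  have hexp : Real.exp (-lam) = η / 2 := by rw [hlam, neg_neg, Real.exp_log (by positivity)]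
  set a₁ : ℝ := min a (-(4 * |t| + 4 * |t'|) - lam / β) with ha₁
  have ha₁a : a₁ ≤ a := min_le_left _ _
  have ha₁' : β * (a₁ + (4 * |t| + 4 * |t'|)) ≤ -lam := by
    have h2 : a₁ ≤ -(4 * |t| + 4 * |t'|) - lam / β := min_le_right _ _
    have h3 : a₁ + (4 * |t| + 4 * |t'|) ≤ -(lam / β) := by linarith
    calc β * (a₁ + (4 * |t| + 4 * |t'|)) ≤ β * (-(lam / β)) := mul_le_mul_of_nonneg_left h3 hβ'.le
      _ = -lam := by field_simp
  have hup := gcPressureTT'Zeeman_le_spinDownSup_add_exp hβ t t' hU a₁ b lam ha₁'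
  rw [hexp] at hup
  have hlow := hc a₁
  have hsign : 0 ≤ β * c * (a₁ - a) := by
    have : β * c ≤ 0 := mul_nonpos_of_nonneg_of_nonpos hβ'.le hc0
    nlinarith
  linarith

/-- **Particle–hole symmetry in the spin variables**: `P((a+b)/2,(a−b)/2) = β(a + b − U) + P̃((a'+b')/2,(a'−b')/2)` with
`a' = U − a`, `b' = U − b`, `P̃` the pressure at `(t, −t', U)`. [cite: LiebWuPhysicaA2003, §1 eq. (3)] -/
theorem gcPressureTT'Zeeman_particleHole_spin (a b : ℝ) :
    gcPressureTT'Zeeman β t t' U ((a + b) / 2) ((a - b) / 2) =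
      β * (a + b - U) + gcPressureTT'Zeeman β t (-t') U (((U - a) + (U - b)) / 2) (((U - a) - (U - b)) / 2) := by
  rw [gcPressureTT'Zeeman_particleHole hβ t t' hU]
  have e1 : U - (a + b) / 2 = ((U - a) + (U - b)) / 2 := by ring
  have e2 : -((a - b) / 2) = ((U - a) - (U - b)) / 2 := by ring
  rw [e1, e2]
  ring

/-- **Subgradients of the pressure in the spin-up variable are BELOW `1`** (`β > 0`): particle–hole symmetry turns
`1 − c` into a subgradient of the reflected pressure, which is positive. [cite: Ruelle1969, §3.4] [cite: Griffiths1964] -/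
theorem lt_one_of_forall_mul_sub_le_gcPressureTT'Zeeman_spinUp_sub (hβ' : 0 < β) (a b : ℝ) {c : ℝ}
    (hc : ∀ a₁ : ℝ, β * c * (a₁ - a) ≤ gcPressureTT'Zeeman β t t' U ((a₁ + b) / 2) ((a₁ - b) / 2) -
      gcPressureTT'Zeeman β t t' U ((a + b) / 2) ((a - b) / 2)) :
    c < 1 := by
  have h := pos_of_forall_mul_sub_le_gcPressureTT'Zeeman_spinUp_sub hβ t (-t') hU hβ' (U - a) (U - b) (c := 1 - c)
    fun a₁' => by
      have h1 := hc (U - a₁')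
      rw [gcPressureTT'Zeeman_particleHole_spin hβ t t' hU (U - a₁') b,
        gcPressureTT'Zeeman_particleHole_spin hβ t t' hU a b, show U - (U - a₁') = a₁' by ring] at h1
      nlinarith
  linarith

/-- The pressure in the spin variables is symmetric under `a ↔ b` (spin flip `h ↦ −h`). [cite: LiebPRL1989, proof of Theorem 1] -/
theorem gcPressureTT'Zeeman_spin_swap (a b : ℝ) :
    gcPressureTT'Zeeman β t t' U ((a + b) / 2) ((a - b) / 2) = gcPressureTT'Zeeman β t t' U ((b + a) / 2) ((b - a) / 2) := by
  rw [show (b - a) / 2 = -((a - b) / 2) by ring, gcPressureTT'Zeeman_neg hβ t t' hU, add_comm]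

end SpinVariables

/-! #### The spin-resolved chemical-potential bands of an attained pair -/

section Bands

variable {β : ℝ} (hβ : 0 ≤ β) (t t' : ℝ) {U : ℝ} (hU : 0 ≤ U)
include hβ hU

/-- **The spin-up band of an attained pair**: if `(x, y) ∈ (0,1)²` attains the Zeeman Legendre supremum at `(μ, h)`,
`p₂(x,y) + βμ(x+y) + βh(x−y) = P(μ,h)`, then `log(x/(1−x)) − β(4|t|+4|t'|) ≤ β(μ + h) ≤ log(x/(1−x)) + β(4|t|+4|t'|+U)`
(chords of the spin-up density leg against the binary-entropy tangents, then `x' → x`).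
[cite: Ruelle1969, §3.4] [cite: Israel1979, Thm. I.2.4] -/
theorem spinUp_chemicalPotential_mem_band {μ hz x y : ℝ} (hx0 : 0 < x) (hx1 : x < 1) (hy0 : 0 ≤ y) (hy1 : y < 1)
    (heq : pressureTT'₂ β t t' U x y + (β * μ * (x + y) + β * hz * (x - y)) = gcPressureTT'Zeeman β t t' U μ hz) :
    Real.log (x / (1 - x)) - β * (4 * |t| + 4 * |t'|) ≤ β * (μ + hz) ∧
      β * (μ + hz) ≤ Real.log (x / (1 - x)) + β * (4 * |t| + 4 * |t'| + U) := by
  have hcont := continuousAt_log_div_one_sub hx0 hx1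
  constructor
  · -- lower chords from `x'' ∈ (0, x)`: `log(x''/(1−x'')) − βC ≤ β(μ+h)`
    have hchord : ∀ u ∈ Set.Ioo 0 x, Real.log (u / (1 - u)) - β * (4 * |t| + 4 * |t'|) ≤ β * (μ + hz) := by
      intro u hu
      have hleg := (pressureTT'₂_sub_binEntropy_sub_mem_fst hβ t t' hU hu.1.le hu.2.le hx1 hy0 hy1).2
      have hP := pressureTT'₂_add_le_gcPressureTT'Zeeman hβ t t' hU μ hz hu.1.le (hu.2.trans hx1) hy0 hy1
      -- binary-entropy chord: `H_b(x) − H_b(u) ≤ (x − u) log((1−u)/u)`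
      have hch := two_mul_binEntropy_sub_le_mul_log (x := 2 * u) (y := 2 * x) (by linarith [hu.1]) (by linarith [hu.2])
        (by linarith)
      rw [show 2 * x / 2 = x by ring, show 2 * u / 2 = u by ring,
        show (2 - 2 * u) / (2 * u) = (1 - u) / u by
          rw [show (2 : ℝ) - 2 * u = 2 * (1 - u) by ring, mul_div_mul_left _ _ (two_ne_zero' ℝ)]] at hch
      have hlog : Real.log (u / (1 - u)) = -Real.log ((1 - u) / u) := by
        rw [← Real.log_inv, inv_div]
      rw [hlog]
      -- `β(μ+h)(x − u) ≥ p₂(x,y) − p₂(u,y) ≥ …`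
      have hxu : 0 < x - u := by linarith [hu.2]
      have key : (x - u) * (-Real.log ((1 - u) / u) - β * (4 * |t| + 4 * |t'|)) ≤ (x - u) * (β * (μ + hz)) := by
        nlinarith
      exact le_of_mul_le_mul_left key hxu
    have hlim : Tendsto (fun u : ℝ => Real.log (u / (1 - u)) - β * (4 * |t| + 4 * |t'|)) (𝓝[Set.Ioo 0 x] x)
        (𝓝 (Real.log (x / (1 - x)) - β * (4 * |t| + 4 * |t'|))) :=
      tendsto_nhdsWithin_of_tendsto_nhds ((hcont.tendsto).sub tendsto_const_nhds)
    haveI : (𝓝[Set.Ioo 0 x] x).NeBot := by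
      rw [← mem_closure_iff_nhdsWithin_neBot, closure_Ioo hx0.ne]; exact ⟨hx0.le, le_rfl⟩
    exact le_of_tendsto hlim (eventually_nhdsWithin_of_forall hchord)
  · -- upper chords from `x' ∈ (x, 1)`: `β(μ+h) ≤ log(x'/(1−x')) + β(C+U)`
    have hchord : ∀ u ∈ Set.Ioo x 1, β * (μ + hz) ≤ Real.log (u / (1 - u)) + β * (4 * |t| + 4 * |t'| + U) := by
      intro u hu
      have hu0 : 0 < u := hx0.trans hu.1
      have hleg := (pressureTT'₂_sub_binEntropy_sub_mem_fst hβ t t' hU hx0.le hu.1.le hu.2 hy0 hy1).1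
      have hP := pressureTT'₂_add_le_gcPressureTT'Zeeman hβ t t' hU μ hz hu0.le hu.2 hy0 hy1
      -- binary-entropy chord: `(u − x) log((1−u)/u) ≤ H_b(u) − H_b(x)`
      have hch := mul_log_le_two_mul_binEntropy_sub (x := 2 * x) (y := 2 * u) (by linarith) (by linarith [hu.1])
        (by linarith [hu.2])
      rw [show 2 * x / 2 = x by ring, show 2 * u / 2 = u by ring,
        show (2 - 2 * u) / (2 * u) = (1 - u) / u by
          rw [show (2 : ℝ) - 2 * u = 2 * (1 - u) by ring, mul_div_mul_left _ _ (two_ne_zero' ℝ)]] at hch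
      have hlog : Real.log (u / (1 - u)) = -Real.log ((1 - u) / u) := by
        rw [← Real.log_inv, inv_div]
      rw [hlog]
      have hux : 0 < u - x := by linarith [hu.1]
      have key : (u - x) * (β * (μ + hz)) ≤ (u - x) * (-Real.log ((1 - u) / u) + β * (4 * |t| + 4 * |t'| + U)) := by
        nlinarith
      exact le_of_mul_le_mul_left key hux
    have hlim : Tendsto (fun u : ℝ => Real.log (u / (1 - u)) + β * (4 * |t| + 4 * |t'| + U)) (𝓝[Set.Ioo x 1] x)
        (𝓝 (Real.log (x / (1 - x)) + β * (4 * |t| + 4 * |t'| + U))) :=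
      tendsto_nhdsWithin_of_tendsto_nhds ((hcont.tendsto).add tendsto_const_nhds)
    haveI : (𝓝[Set.Ioo x 1] x).NeBot := by
      rw [← mem_closure_iff_nhdsWithin_neBot, closure_Ioo hx1.ne]; exact ⟨le_rfl, hx1.le⟩
    exact ge_of_tendsto hlim (eventually_nhdsWithin_of_forall hchord)

/-- **The spin-down band of an attained pair** (swap `x ↔ y`, `h ↦ −h`):
`log(y/(1−y)) − β(4|t|+4|t'|) ≤ β(μ − h) ≤ log(y/(1−y)) + β(4|t|+4|t'|+U)`. [cite: Ruelle1969, §3.4] -/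
theorem spinDown_chemicalPotential_mem_band {μ hz x y : ℝ} (hx0 : 0 ≤ x) (hx1 : x < 1) (hy0 : 0 < y) (hy1 : y < 1)
    (heq : pressureTT'₂ β t t' U x y + (β * μ * (x + y) + β * hz * (x - y)) = gcPressureTT'Zeeman β t t' U μ hz) :
    Real.log (y / (1 - y)) - β * (4 * |t| + 4 * |t'|) ≤ β * (μ - hz) ∧
      β * (μ - hz) ≤ Real.log (y / (1 - y)) + β * (4 * |t| + 4 * |t'| + U) := by
  have heq' : pressureTT'₂ β t t' U y x + (β * μ * (y + x) + β * (-hz) * (y - x)) =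
      gcPressureTT'Zeeman β t t' U μ (-hz) := by
    rw [gcPressureTT'Zeeman_neg hβ t t' hU, ← pressureTT'₂_swap hβ t t' hU hx0 hx1 hy0.le hy1, ← heq]
    ring
  have h := spinUp_chemicalPotential_mem_band hβ t t' hU hy0 hy1 hx0 hx1 heq'
  rwa [← sub_eq_add_neg] at h

end Bands

end ThermodynamicLimit

/-! ### §2 Spin densities of thermal grand-canonical states in a field -/

namespace InfVolFermionState

section SpinDensities

variable {β : ℝ} (hβ : 0 ≤ β) (t t' : ℝ) {U : ℝ} (hU : 0 ≤ U) (μ hz : ℝ)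
  {ω : InfVolFermionState 2} {Ls : ℕ → ℕ}
include hβ hU

/-- **`(ρ, m)` is a joint subgradient of the Zeeman pressure in `(μ, h)`**: for every `(μ₁, h₁)`,
`βρ(ω)(μ₁ − μ) + βm(ω)(h₁ − h) ≤ P(μ₁,h₁) − P(μ,h)`. [cite: Griffiths1964] [cite: Ruelle1969, §3.4] -/
theorem IsTorusLimitOfMixture.mul_density_add_mul_magnetisation_le_gcPressureTT'Zeeman_sub_of_gcGibbs
    (hω : ω.IsTorusLimitOfMixture sourcedGibbsCount (gcGibbsWeightTT' β t t' U μ hz)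
      (gcGibbsVectorTT' t t' U μ hz) Ls)
    (hLs : Tendsto Ls atTop atTop) (μ₁ h₁ : ℝ) :
    β * ω.density * (μ₁ - μ) +
        β * ((ω.expect ({0} : Finset (Site 2)) (nAt 0 (Finset.mem_singleton_self 0) 0)).re -
          (ω.expect ({0} : Finset (Site 2)) (nAt 0 (Finset.mem_singleton_self 0) 1)).re) * (h₁ - hz) ≤
      gcPressureTT'Zeeman β t t' U μ₁ h₁ - gcPressureTT'Zeeman β t t' U μ hz := by
  have h := hω.gcPressureTT'Zeeman_sub_le_of_gcGibbs hβ t t' hU μ hz hLs hβ t t' hU μ₁ h₁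
  calc β * ω.density * (μ₁ - μ) +
        β * ((ω.expect ({0} : Finset (Site 2)) (nAt 0 (Finset.mem_singleton_self 0) 0)).re -
          (ω.expect ({0} : Finset (Site 2)) (nAt 0 (Finset.mem_singleton_self 0) 1)).re) * (h₁ - hz)
      = -(β * (ω.meanEnergy (hubbardTTPrimeFermionInteraction t t' U) 1 - μ₁ * ω.density -
            h₁ * ((ω.expect ({0} : Finset (Site 2)) (nAt 0 (Finset.mem_singleton_self 0) 0)).re -
              (ω.expect ({0} : Finset (Site 2)) (nAt 0 (Finset.mem_singleton_self 0) 1)).re)) -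
          β * (ω.meanEnergy (hubbardTTPrimeFermionInteraction t t' U) 1 - μ * ω.density -
            hz * ((ω.expect ({0} : Finset (Site 2)) (nAt 0 (Finset.mem_singleton_self 0) 0)).re -
              (ω.expect ({0} : Finset (Site 2)) (nAt 0 (Finset.mem_singleton_self 0) 1)).re))) := by ring
    _ ≤ _ := by linarith

omit hβ hU in
/-- The density splits into the spin densities: `ρ(ω) = Re ω(n_{0↑}) + Re ω(n_{0↓})`. [cite: ArakiMoriya2003, §4.1] -/
theorem density_eq_re_expect_nAt_add (ω : InfVolFermionState 2) :
    ω.density = (ω.expect ({0} : Finset (Site 2)) (nAt 0 (Finset.mem_singleton_self 0) 0)).re +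
      (ω.expect ({0} : Finset (Site 2)) (nAt 0 (Finset.mem_singleton_self 0) 1)).re := by
  rw [InfVolFermionState.density, InfVolFermionState.densityAt, map_add, Complex.add_re]

omit hβ hU in
/-- **The spin-up density is a subgradient in the variable `a = μ + h`**: for every `a₁`,
`βρ↑(ω)(a₁ − a) ≤ P((a₁+b)/2,(a₁−b)/2) − P((a+b)/2,(a−b)/2)` with `a = μ + h`, `b = μ − h`.
[cite: Griffiths1964] [cite: Ruelle1969, §3.4] -/
theorem IsTorusLimitOfMixture.mul_spinUp_mul_sub_le_gcPressureTT'Zeeman_sub_of_gcGibbs (hβ : 0 ≤ β) (hU : 0 ≤ U)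
    (hω : ω.IsTorusLimitOfMixture sourcedGibbsCount (gcGibbsWeightTT' β t t' U μ hz)
      (gcGibbsVectorTT' t t' U μ hz) Ls)
    (hLs : Tendsto Ls atTop atTop) (a₁ : ℝ) :
    β * (ω.expect ({0} : Finset (Site 2)) (nAt 0 (Finset.mem_singleton_self 0) 0)).re * (a₁ - (μ + hz)) ≤
      gcPressureTT'Zeeman β t t' U ((a₁ + (μ - hz)) / 2) ((a₁ - (μ - hz)) / 2) -
        gcPressureTT'Zeeman β t t' U (((μ + hz) + (μ - hz)) / 2) (((μ + hz) - (μ - hz)) / 2) := by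
  have h := hω.mul_density_add_mul_magnetisation_le_gcPressureTT'Zeeman_sub_of_gcGibbs hβ t t' hU μ hz hLs
    ((a₁ + (μ - hz)) / 2) ((a₁ - (μ - hz)) / 2)
  rw [density_eq_re_expect_nAt_add] at h
  have e1 : ((μ + hz) + (μ - hz)) / 2 = μ := by ring
  have e2 : ((μ + hz) - (μ - hz)) / 2 = hz := by ring
  rw [e1, e2]
  calc β * (ω.expect ({0} : Finset (Site 2)) (nAt 0 (Finset.mem_singleton_self 0) 0)).re * (a₁ - (μ + hz))
      = β * ((ω.expect ({0} : Finset (Site 2)) (nAt 0 (Finset.mem_singleton_self 0) 0)).re +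
            (ω.expect ({0} : Finset (Site 2)) (nAt 0 (Finset.mem_singleton_self 0) 1)).re) *
            ((a₁ + (μ - hz)) / 2 - μ) +
          β * ((ω.expect ({0} : Finset (Site 2)) (nAt 0 (Finset.mem_singleton_self 0) 0)).re -
            (ω.expect ({0} : Finset (Site 2)) (nAt 0 (Finset.mem_singleton_self 0) 1)).re) *
            ((a₁ - (μ - hz)) / 2 - hz) := by ring
    _ ≤ _ := h

omit hβ hU in
/-- **The spin-down density is a subgradient in the variable `b = μ − h`** (written in the swapped form ready for
the spin-up lemmas): for every `b₁`, `βρ↓(ω)(b₁ − b) ≤ P((b₁+a)/2,(b₁−a)/2) − P((b+a)/2,(b−a)/2)`.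
[cite: Griffiths1964] [cite: Ruelle1969, §3.4] -/
theorem IsTorusLimitOfMixture.mul_spinDown_mul_sub_le_gcPressureTT'Zeeman_sub_of_gcGibbs (hβ : 0 ≤ β) (hU : 0 ≤ U)
    (hω : ω.IsTorusLimitOfMixture sourcedGibbsCount (gcGibbsWeightTT' β t t' U μ hz)
      (gcGibbsVectorTT' t t' U μ hz) Ls)
    (hLs : Tendsto Ls atTop atTop) (b₁ : ℝ) :
    β * (ω.expect ({0} : Finset (Site 2)) (nAt 0 (Finset.mem_singleton_self 0) 1)).re * (b₁ - (μ - hz)) ≤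
      gcPressureTT'Zeeman β t t' U ((b₁ + (μ + hz)) / 2) ((b₁ - (μ + hz)) / 2) -
        gcPressureTT'Zeeman β t t' U (((μ - hz) + (μ + hz)) / 2) (((μ - hz) - (μ + hz)) / 2) := by
  have h := hω.mul_density_add_mul_magnetisation_le_gcPressureTT'Zeeman_sub_of_gcGibbs hβ t t' hU μ hz hLs
    ((b₁ + (μ + hz)) / 2) (((μ + hz) - b₁) / 2)
  rw [density_eq_re_expect_nAt_add] at h
  rw [← gcPressureTT'Zeeman_spin_swap hβ t t' hU (μ + hz) b₁, ← gcPressureTT'Zeeman_spin_swap hβ t t' hU (μ + hz) (μ - hz)]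
  have e1 : ((μ + hz) + (μ - hz)) / 2 = μ := by ring
  have e2 : ((μ + hz) - (μ - hz)) / 2 = hz := by ring
  have e3 : ((μ + hz) + b₁) / 2 = (b₁ + (μ + hz)) / 2 := by ring
  rw [e1, e2, e3]
  calc β * (ω.expect ({0} : Finset (Site 2)) (nAt 0 (Finset.mem_singleton_self 0) 1)).re * (b₁ - (μ - hz))
      = β * ((ω.expect ({0} : Finset (Site 2)) (nAt 0 (Finset.mem_singleton_self 0) 0)).re +
            (ω.expect ({0} : Finset (Site 2)) (nAt 0 (Finset.mem_singleton_self 0) 1)).re) *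
            ((b₁ + (μ + hz)) / 2 - μ) +
          β * ((ω.expect ({0} : Finset (Site 2)) (nAt 0 (Finset.mem_singleton_self 0) 0)).re -
            (ω.expect ({0} : Finset (Site 2)) (nAt 0 (Finset.mem_singleton_self 0) 1)).re) *
            (((μ + hz) - b₁) / 2 - hz) := by ring
    _ ≤ _ := h

/-- **The spin densities of a thermal grand-canonical state are interior**: `0 < Re ω(n_{0↑}) < 1` (`β > 0`, any field).
[cite: Ruelle1969, §3.4] [cite: Griffiths1964] -/
theorem IsTorusLimitOfMixture.spinUp_mem_Ioo_of_gcGibbs (hβ' : 0 < β)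
    (hω : ω.IsTorusLimitOfMixture sourcedGibbsCount (gcGibbsWeightTT' β t t' U μ hz)
      (gcGibbsVectorTT' t t' U μ hz) Ls)
    (hLs : Tendsto Ls atTop atTop) :
    (ω.expect ({0} : Finset (Site 2)) (nAt 0 (Finset.mem_singleton_self 0) 0)).re ∈ Set.Ioo (0 : ℝ) 1 :=
  ⟨ThermodynamicLimit.pos_of_forall_mul_sub_le_gcPressureTT'Zeeman_spinUp_sub hβ t t' hU hβ' (μ + hz) (μ - hz)
      fun a₁ => hω.mul_spinUp_mul_sub_le_gcPressureTT'Zeeman_sub_of_gcGibbs t t' μ hz hβ hU hLs a₁,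
    ThermodynamicLimit.lt_one_of_forall_mul_sub_le_gcPressureTT'Zeeman_spinUp_sub hβ t t' hU hβ' (μ + hz) (μ - hz)
      fun a₁ => hω.mul_spinUp_mul_sub_le_gcPressureTT'Zeeman_sub_of_gcGibbs t t' μ hz hβ hU hLs a₁⟩

/-- **… and `0 < Re ω(n_{0↓}) < 1`.** [cite: Ruelle1969, §3.4] [cite: Griffiths1964] -/
theorem IsTorusLimitOfMixture.spinDown_mem_Ioo_of_gcGibbs (hβ' : 0 < β)
    (hω : ω.IsTorusLimitOfMixture sourcedGibbsCount (gcGibbsWeightTT' β t t' U μ hz)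
      (gcGibbsVectorTT' t t' U μ hz) Ls)
    (hLs : Tendsto Ls atTop atTop) :
    (ω.expect ({0} : Finset (Site 2)) (nAt 0 (Finset.mem_singleton_self 0) 1)).re ∈ Set.Ioo (0 : ℝ) 1 :=
  ⟨ThermodynamicLimit.pos_of_forall_mul_sub_le_gcPressureTT'Zeeman_spinUp_sub hβ t t' hU hβ' (μ - hz) (μ + hz)
      fun b₁ => hω.mul_spinDown_mul_sub_le_gcPressureTT'Zeeman_sub_of_gcGibbs t t' μ hz hβ hU hLs b₁,
    ThermodynamicLimit.lt_one_of_forall_mul_sub_le_gcPressureTT'Zeeman_spinUp_sub hβ t t' hU hβ' (μ - hz) (μ + hz)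
      fun b₁ => hω.mul_spinDown_mul_sub_le_gcPressureTT'Zeeman_sub_of_gcGibbs t t' μ hz hβ hU hLs b₁⟩

/-- **THE `(n↑, n↓) ↔ (μ, h)` DUALITY AT THE STATE LEVEL** (`β > 0`, `U ≥ 0`, any field): the spin densities of every
thermal grand-canonical state ATTAIN the two-variable Legendre transform,
`p₂(ρ↑(ω), ρ↓(ω)) + βμρ(ω) + βh m(ω) = P(μ, h)` (`p₂ = pressureTT'₂`, the spin-resolved canonical pressure of record).
[cite: Ruelle1969, §3.4] [cite: Israel1979, Thm. I.2.4] -/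
theorem IsTorusLimitOfMixture.pressureTT'₂_add_eq_gcPressureTT'Zeeman_of_gcGibbs (hβ' : 0 < β)
    (hω : ω.IsTorusLimitOfMixture sourcedGibbsCount (gcGibbsWeightTT' β t t' U μ hz)
      (gcGibbsVectorTT' t t' U μ hz) Ls)
    (hLs : Tendsto Ls atTop atTop) :
    pressureTT'₂ β t t' U (ω.expect ({0} : Finset (Site 2)) (nAt 0 (Finset.mem_singleton_self 0) 0)).re
          (ω.expect ({0} : Finset (Site 2)) (nAt 0 (Finset.mem_singleton_self 0) 1)).re +
        (β * μ * ((ω.expect ({0} : Finset (Site 2)) (nAt 0 (Finset.mem_singleton_self 0) 0)).re +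
            (ω.expect ({0} : Finset (Site 2)) (nAt 0 (Finset.mem_singleton_self 0) 1)).re) +
          β * hz * ((ω.expect ({0} : Finset (Site 2)) (nAt 0 (Finset.mem_singleton_self 0) 0)).re -
            (ω.expect ({0} : Finset (Site 2)) (nAt 0 (Finset.mem_singleton_self 0) 1)).re)) =
      gcPressureTT'Zeeman β t t' U μ hz := by
  set x := (ω.expect ({0} : Finset (Site 2)) (nAt 0 (Finset.mem_singleton_self 0) 0)).re with hx
  set y := (ω.expect ({0} : Finset (Site 2)) (nAt 0 (Finset.mem_singleton_self 0) 1)).re with hy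
  obtain ⟨hx0, hx1⟩ := hω.spinUp_mem_Ioo_of_gcGibbs hβ t t' hU μ hz hβ' hLs
  obtain ⟨hy0, hy1⟩ := hω.spinDown_mem_Ioo_of_gcGibbs hβ t t' hU μ hz hβ' hLs
  refine le_antisymm (pressureTT'₂_add_le_gcPressureTT'Zeeman hβ t t' hU μ hz hx0.le hx1 hy0.le hy1) ?_
  have hsub : ∀ μ₁ h₁ : ℝ, β * (x + y) * (μ₁ - μ) + β * (x - y) * (h₁ - hz) ≤
      gcPressureTT'Zeeman β t t' U μ₁ h₁ - gcPressureTT'Zeeman β t t' U μ hz := by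
    intro μ₁ h₁
    have h := hω.mul_density_add_mul_magnetisation_le_gcPressureTT'Zeeman_sub_of_gcGibbs hβ t t' hU μ hz hLs μ₁ h₁
    rwa [density_eq_re_expect_nAt_add] at h
  have hinf : gcPressureTT'Zeeman β t t' U μ hz - β * μ * (x + y) - β * hz * (x - y) ≤ pressureTT'₂ β t t' U x y := by
    rw [pressureTT'₂_eq_iInf_gcPressureTT'Zeeman hβ t t' hU hβ' hx0 hx1 hy0 hy1]
    refine le_ciInf fun q => ?_
    have h := hsub q.1 q.2
    nlinarith
  linarith

/-- **THE HYPOTHESIS-FREE SPIN-DENSITY WINDOWS** (`β > 0`, `U ≥ 0`): with `C = 4|t| + 4|t'|`, `σ(z) = e^z/(1+e^z)`,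
`σ(β(μ+h) − β(C+U)) ≤ ρ↑(ω) ≤ σ(β(μ+h) + βC)` and `σ(β(μ−h) − β(C+U)) ≤ ρ↓(ω) ≤ σ(β(μ−h) + βC)` — the ideal
spin-½ lattice gas in the field, displaced by one bandwidth (plus `U` below); subtracting gives a magnetisation window
on the field axis. [cite: Ruelle1969, §3.4] [cite: Israel1979, Thm. I.2.4] -/
theorem IsTorusLimitOfMixture.spinDensities_mem_Icc_logistic_of_gcGibbs (hβ' : 0 < β)
    (hω : ω.IsTorusLimitOfMixture sourcedGibbsCount (gcGibbsWeightTT' β t t' U μ hz)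
      (gcGibbsVectorTT' t t' U μ hz) Ls)
    (hLs : Tendsto Ls atTop atTop) :
    (ω.expect ({0} : Finset (Site 2)) (nAt 0 (Finset.mem_singleton_self 0) 0)).re ∈ Set.Icc
        (Real.exp (β * (μ + hz) - β * (4 * |t| + 4 * |t'| + U)) / (1 + Real.exp (β * (μ + hz) - β * (4 * |t| + 4 * |t'| + U))))
        (Real.exp (β * (μ + hz) + β * (4 * |t| + 4 * |t'|)) / (1 + Real.exp (β * (μ + hz) + β * (4 * |t| + 4 * |t'|)))) ∧
      (ω.expect ({0} : Finset (Site 2)) (nAt 0 (Finset.mem_singleton_self 0) 1)).re ∈ Set.Icc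
        (Real.exp (β * (μ - hz) - β * (4 * |t| + 4 * |t'| + U)) / (1 + Real.exp (β * (μ - hz) - β * (4 * |t| + 4 * |t'| + U))))
        (Real.exp (β * (μ - hz) + β * (4 * |t| + 4 * |t'|)) / (1 + Real.exp (β * (μ - hz) + β * (4 * |t| + 4 * |t'|)))) := by
  set x := (ω.expect ({0} : Finset (Site 2)) (nAt 0 (Finset.mem_singleton_self 0) 0)).re with hx
  set y := (ω.expect ({0} : Finset (Site 2)) (nAt 0 (Finset.mem_singleton_self 0) 1)).re with hy
  obtain ⟨hx0, hx1⟩ := hω.spinUp_mem_Ioo_of_gcGibbs hβ t t' hU μ hz hβ' hLs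
  obtain ⟨hy0, hy1⟩ := hω.spinDown_mem_Ioo_of_gcGibbs hβ t t' hU μ hz hβ' hLs
  have heq := hω.pressureTT'₂_add_eq_gcPressureTT'Zeeman_of_gcGibbs hβ t t' hU μ hz hβ' hLs
  obtain ⟨hlo₁, hhi₁⟩ := spinUp_chemicalPotential_mem_band hβ t t' hU hx0 hx1 hy0.le hy1 heq
  obtain ⟨hlo₂, hhi₂⟩ := spinDown_chemicalPotential_mem_band hβ t t' hU hx0.le hx1 hy0 hy1 heq
  -- logistic inversion: `A ≤ z/(1−z) ≤ B  ⇒  A/(1+A) ≤ z ≤ B/(1+B)`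
  have inv : ∀ {z lo hi : ℝ}, 0 < z → z < 1 → lo ≤ Real.log (z / (1 - z)) → Real.log (z / (1 - z)) ≤ hi →
      z ∈ Set.Icc (Real.exp lo / (1 + Real.exp lo)) (Real.exp hi / (1 + Real.exp hi)) := by
    intro z lo hi hz0 hz1 hlo hhi
    have hq : 0 < z / (1 - z) := div_pos hz0 (by linarith)
    have hexp : Real.exp (Real.log (z / (1 - z))) = z / (1 - z) := Real.exp_log hq
    constructor
    · have h1 : Real.exp lo ≤ z / (1 - z) := by rw [← hexp]; exact Real.exp_le_exp.2 hlo
      have h2 : Real.exp lo * (1 - z) ≤ z := (le_div_iff₀ (by linarith)).1 h1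
      rw [div_le_iff₀ (by positivity)]
      nlinarith [Real.exp_pos lo]
    · have h1 : z / (1 - z) ≤ Real.exp hi := by rw [← hexp]; exact Real.exp_le_exp.2 hhi
      have h2 : z ≤ Real.exp hi * (1 - z) := (div_le_iff₀ (by linarith)).1 h1
      rw [le_div_iff₀ (by positivity)]
      nlinarith [Real.exp_pos hi]
  exact ⟨inv hx0 hx1 (by linarith) (by linarith), inv hy0 hy1 (by linarith) (by linarith)⟩

end SpinDensities

end InfVolFermionState

end Literature.MathematicalPhysics.QuantumLattice

end
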